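import Summits.BirchSwinnertonDyer.BirchSwinnertonDyer.Theorems.CMKolyvaginAtInertTwoPointSystemWithRootsOnGivenFrameAtTwo
import Summits.BirchSwinnertonDyer.BirchSwinnertonDyer.Theorems.CMKolyvaginAtInertTwoMinusPartRefinedDescentAtTwoPow
import Summits.BirchSwinnertonDyer.BirchSwinnertonDyer.Theorems.CMKolyvaginAtInertTwoKolyvaginPrimeInertAtTwo
import HarnessLib

/-!
# Route `CMKolyvaginAtInertTwo`, crux `CMKolyvaginConjectureAtInertTwo` (stmt-BirchSwinnertonDyer-24648),
# stub `stub_positiveDepth` — THE REFINED `(−ε)`-DESCENT AND KOLYVAGIN'S CONVERSE AT `2` ON H₂, ON THE GIVEN FRAME: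
# a class of order `≥ 4·2^j` in `Sel_{2^M}(E/K)^{ν}` forces a deep CM-inert Kolyvagin prime `ℓ` and a Kolyvagin–Heegner
# datum `e : KolyvaginHeegnerData Dt β ι ℓ` ON THE CRUX'S FRAME `(Dt, β, ι)` with `2^{m₁} ∤ P_e(ℓ)` in `E(K[ℓ])`

Seat `leafhand-bsd-cmkolyvaginatinert-9` g0 (cell `bsd-eis`); helper `--supports stmt-BirchSwinnertonDyer-24648`
(brief `BRIEF-cmk-9-alpha1-OnGivenFrame`, file F2 of three).  THEOREMS ONLY: no definition, no named fact, no `sorry`;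
no stub, crux or summit is closed; BSD is proved for no curve.

WHAT.  Hand 7's files `…MinusPartRefinedDescentOnHTwoAtTwoPow` (§1 point system at `2` on H₂ with roots, §2 refined
`(−ε)`-descent by name) and `…StrictDescentOfSelmerMinusAtTwo` (Kolyvagin's converse) RE-ISSUED with the machine of
the previous file (`PointSystemWithRootsOnGivenFrame.hpoints_at_with_roots_onFrame_of_perLevelChoice`: the frame
`(Dt, β, ι)` is an INPUT), so that every root hypothesis and every witnessing datum is a
`KolyvaginHeegnerData Dt β ι ℓ` on the GIVEN frame — census (α1), the FRAME GAP of hand 8's file #4 closed at the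
level of the machine.  Frame inputs throughout: `(Dt, β, ι)`, ONE conductor-`1` datum `d₁`, and the `K`-rational
Heegner point `P` under `P(1)` (`hHP : IsHeegnerPoint N W K P`, `hmap : P ↦ P(1)`; hand 8's `…EpsilonLineOnHTwo` §1).
* §1 `hpoints_two_with_roots_onFrame_of_cmInert_of_oddTamagawa` — the `p = 2` specialisation on H₂ (ty2's discharges
  of `hCM`, `hloc`, `hAdm`, `h44`; named fact `prop37_2_reductionCongruence_inert`; printed binder `h53`), proof =
  hand 7's verbatim with the frame fed in.
* §2 `two_pow_smul_selmer_minus_eq_zero_of_dvd_derivedPoint_onFrame_two_pow` — **`2^{M₀−m₁+1}·Sel_{2^M}(E/K)^{ν} = 0`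
  when every `P_e(ℓ)`, `e : KolyvaginHeegnerData Dt β ι ℓ` ON THE GIVEN FRAME at a Kolyvagin prime `ℓ` at `2` with
  `Frob_ℓ = Frob_∞` on `K(E[2^{M+m₁}])`, is `2^{m₁}`-divisible in `E(K[ℓ])`** (the route's
  `two_pow_smul_selmer_minus_eq_zero_of_root_two_pow` fed with §1; inputs = the route's standing machine inputs at `2`).
* §3 `exists_not_dvd_derivedPoint_onFrame_of_selmer_minus_two_pow`,
  `exists_strictDescent_onFrame_of_selmer_minus_two_zsmul_ne_zero` — the contrapositives: `s ∈ Sel_{2^M}(E/K)`,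
  `c_* s = ν s`, `2^{M₀−m₁+1}·s ≠ 0` (resp. `2·s ≠ 0`, `m₁ = M₀`) ⟹ a CM-inert Kolyvagin prime `ℓ` at `2` with
  `Frob_ℓ = Frob_∞` on `K(E[2^{M+m₁}])` and **`e : KolyvaginHeegnerData Dt β ι ℓ`** with `2^{m₁} ∤ P_e(ℓ)`.

HONEST FRAMING.  Plumbing: hand 7's three theorems with one input re-routed; conditional, exactly like every descent
file of this route at `2`, on ty2's reciprocity DATA `R`, the Cartan-type `z`/`hzfix`/`hcomm`, `Δ_E < 0`, `Δ_E ∉ K²`,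
Gross 3.7 (2) as the named fact `prop37_2_reductionCongruence_inert N W K` and Gross 5.3 as the binder `h53`.  The
iteration (ε-part, two-prime step) and the SOURCE of the Selmer trigger (census (β)) are untouched.
References: [McCallumLMS1991] §5 Lemma 5.1, Prop. 5.2, Lemma 5.3, Thm. 5.4; [GrossLMS1991] Prop. 2.1, §3 (3.1)–(3.3),
§§4–6, §10; [Kolyvagin1991] (structure of `Ш`).
presearch: as hand 7 (McCallum §5 at odd `p` [corpus: book:editornd-l-functions-arithmetic p0285–p0289]; none at `2`);
tree re-keying only.
-/

-- single-conjunct summit: `Summit.BirchSwinnertonDyer.BirchSwinnertonDyer.…` repeats the name by design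
set_option linter.dupNamespace false
set_option autoImplicit false

noncomputable section

open scoped Classical
open WeierstrassCurve Field NumberField IsDedekindDomain Finset
open Literature.NumberTheory.EllipticCurves Literature.NumberTheory.GaloisRepresentations
open Literature.NumberTheory.EllipticCurves.KolyvaginCocycle
open Literature.NumberTheory.EllipticCurves.KolyvaginEuler
open Literature.NumberTheory.EllipticCurves.RingClassField
open Literature.NumberTheory.EllipticCurves.ModularForms
open Literature.NumberTheory.EllipticCurves.Rank1Residual (CMInert)
open Summit.BirchSwinnertonDyer.Rank1Residual.X11b
open Summit.BirchSwinnertonDyer.Rank1Residual.X11b.KolyvaginAssembly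
open Summit.BirchSwinnertonDyer.Rank1Residual.P2
open Summit.BirchSwinnertonDyer.BirchSwinnertonDyer.Theorems
open Summit.BirchSwinnertonDyer.BirchSwinnertonDyer.Theorems.PointSystemWithRootsOnGivenFrame

namespace Summit.BirchSwinnertonDyer.BirchSwinnertonDyer.Theorems.KolyvaginDescentTwoOnGivenFrame

-- `K : Type`: the tree's ring-class class field theory is universe `0`.
variable {K : Type} [Field K] [NumberField K] {N : ℕ} {W : WeierstrassCurve ℚ}

/-! ## §1 The point system at `2` on H₂ with roots, frame as input -/

/-- **The machine's point system at `p = 2` on H₂ WITH THE ROOT CLAUSE (r) AND THE DATUM CLAUSE (s), ON THE GIVEN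
FRAME** — hand 7's `KolyvaginDescentTwo.hpoints_two_with_roots_of_cmInert_of_oddTamagawa` (= ty2's
`PointSystemOddTamagawa.hpoints_two_of_cmInert_of_oddTamagawa` + (r)) verbatim: CM, `2` inert in `End E`, `ρ̄₂` onto,
odd Tamagawa product, `K` imaginary quadratic with odd `d_K ≠ −3`, Heegner for `N = N_E`, modulo EXACTLY the named
fact `GrossLMS1991.prop37_2_reductionCongruence_inert N W K` and the printed binder `h53` (Gross Prop. 5.3); the frame
inputs are the stub's `(Dt, β, ι)`, ONE conductor-`1` datum `d₁` on it, and the `K`-rational Heegner point `P` under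
`P(1)` (`hHP`, `hmap`; hand 8's `…EpsilonLineOnHTwo` §1).  `hβ := d₁.dvd_sq_sub`, `hc1 :=` §0.
[cite: GrossLMS1991, §3 Props. 3.6, 3.7, §4 (4.1), Lemma 4.3, Props. 5.3, 5.4, 6.2]
[cite: McCallumLMS1991, §4 (4)–(6), Lemma 4.3, Prop. 4.4, §5 (before Prop. 5.2)] [cite: MilneADT2006, Ch. I Prop. 3.8] -/
theorem hpoints_two_with_roots_onFrame_of_cmInert_of_oddTamagawa [NeZero N] [W.IsGloballyMinimal]
    [W.IsElliptic] (hN : N = W.conductorNorm ℤ) (hCMW : W.HasCM) (hin : CMInert W 2)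
    (hsurj : W.HasSurjectiveModNGaloisRep 2) (hT : Odd W.tamagawaProduct)
    (hK : IsImaginaryQuadratic K) (hodd : Odd (NumberField.discr K)) (h3 : NumberField.discr K ≠ -3)
    (hH : SatisfiesHeegnerHypothesis N K)
    (h372 : GrossLMS1991.prop37_2_reductionCongruence_inert N W K)
    (h53 : ∀ [W.IsElliptic] (_hK : IsImaginaryQuadratic K) (_hH : SatisfiesHeegnerHypothesis N K)
      (Dt : ModularParametrizationData W N) (β : ℤ) (ι : K →+* ℂ) {M : ℕ}
      (_hM : 1 ≤ M) {n : ℕ} (_hn : Squarefree n)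
      (_hKol : ∀ q ∈ n.primeFactors, IsKolyvaginPrime N W K 2 q ∧ FrobEqFrobInfty W K (2 ^ M) q)
      (d : (m : ℕ) → m ∣ n → KolyvaginHeegnerData Dt β ι m) (m : ℕ) (hm : m ∣ n)
      (τm : ringClassField K ι m ≃ₐ[ℚ] ringClassField K ι m),
      (∀ x : ringClassField K ι m, ((τm x : ringClassField K ι m) : ℂ) = starRingEnd ℂ x) →
      ∃ σ' ∈ ringClassGal ι m, IsOfFinAddOrder
        (pointGalHom W (ringClassField K ι m) τm (d m hm).y -
          (-W.rootNumber) • pointGalHom W (ringClassField K ι m) σ' (d m hm).y))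
    (Dt : ModularParametrizationData W N) (β : ℤ) (ι : K →+* ℂ) (d₁ : KolyvaginHeegnerData Dt β ι 1)
    {P : (W.baseChange K).toAffine.Point} (hHP : IsHeegnerPoint N W K P)
    (hmap : Affine.Point.map (W' := W) (algebraMap K (ringClassField K ι 1)).toRatAlgHom P = d₁.derivedPoint) :
    ∀ {M : ℕ} (_hM : 1 ≤ M)
      (hdiv : ∀ Q : geomPoints (W.baseChange K), ∃ R, ((2 ^ M : ℕ) : ℤ) • R = Q)
      (c : K ≃ₐ[ℚ] K) (_hc : c ≠ 1),
      ∃ (ε : ℤ) (τ : AlgebraicClosure K ≃+* AlgebraicClosure K) (hτ : IsLiftOfAut c τ)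
        (A : ℕ → AddSubgroup (geomPoints (W.baseChange K)))
        (hA : ∀ m, KolyvaginCocycle.IsAdmissible (Field.absoluteGaloisGroup K) (A m)
          ((2 ^ M : ℕ) : ℤ))
        (Pt : ℕ → geomPoints (W.baseChange K))
        (hPt : ∀ m, Pt m ∈
          KolyvaginCocycle.invPoints (Field.absoluteGaloisGroup K) (A m) ((2 ^ M : ℕ) : ℤ)),
        (ε = 1 ∨ ε = -1) ∧
        IsOfFinAddOrder (Affine.Point.map (W' := W) (c : K →ₐ[ℚ] K) P - ε • P) ∧
        (∀ m, ∀ a ∈ A m, hτ.pointsMap W a ∈ A m) ∧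
        Pt 1 = toGeomPoints (W.baseChange K) P ∧
        (∀ m : ℕ, Squarefree m →
          (∀ q ∈ m.primeFactors, IsKolyvaginPrime N W K 2 q ∧ FrobEqFrobInfty W K (2 ^ M) q) →
          (∃ B ∈ A m, hτ.pointsMap W (Pt m) =
            (ε * (-1) ^ m.primeFactors.card) • Pt m + ((2 ^ M : ℕ) : ℤ) • B) ∧
          (∀ v : HeightOneSpectrum (𝓞 K), (m : 𝓞 K) ∉ v.asIdeal →
            kolyvaginClass (W.baseChange K) _ hdiv (hA m) (Pt m) (hPt m) ∈
              selmerLocalKer (W.baseChange K) (v.adicCompletion K) ((2 ^ M : ℕ) : ℤ)) ∧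
          (∀ ℓ : ℕ, ℓ.Prime → ℓ ∣ m → ∀ v : HeightOneSpectrum (𝓞 K), (ℓ : 𝓞 K) ∈ v.asIdeal →
            ∀ a : ℕ, ((((2 : ℕ) : ℤ) ^ a) •
                kolyvaginClass (W.baseChange K) _ hdiv (hA m) (Pt m) (hPt m) ∈
                selmerLocalKer (W.baseChange K) (v.adicCompletion K) ((2 ^ M : ℕ) : ℤ) ↔
              (((2 : ℕ) : ℤ) ^ a) • kolyvaginClass (W.baseChange K) _ hdiv (hA (m / ℓ)) (Pt (m / ℓ))
                  (hPt (m / ℓ)) ∈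
                (W.baseChange K).torsionLocalKer (v.adicCompletion K) ((2 ^ M : ℕ) : ℤ))) ∧
          (∀ k : ℕ, (∀ e : KolyvaginHeegnerData Dt β ι m,
              ∃ Q₀ : (W.baseChange (ringClassField K ι m)).toAffine.Point,
                (((2 : ℕ) : ℤ) ^ k) • Q₀ = e.derivedPoint) →
            ∃ Q ∈ A m, (((2 : ℕ) : ℤ) ^ k) • Q = Pt m) ∧
          (∃ e : KolyvaginHeegnerData Dt β ι m,
            A m = e.pointsSubgroup ∧ Pt m = e.toGeomPoints e.derivedPoint)) := by
  intro M hM hdiv c hc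
  have h4 : NumberField.discr K ≠ -4 := fun h ↦ by
    rw [h] at hodd
    exact (Int.not_even_iff_odd.mpr hodd) ⟨-2, by norm_num⟩
  have hD34 : NumberField.discr K ≠ -3 ∧ NumberField.discr K ≠ -4 := ⟨h3, h4⟩
  refine hpoints_at_with_roots_onFrame_of_perLevelChoice hN hK hD34 hH hHP Nat.prime_two Dt β ι
    d₁.dvd_sq_sub (toGeomPoints_derivedPoint_one_eq_of_map_eq d₁ hmap) ?_ h53
    (PointSystemOddTamagawa.hloc_two_of_odd_tamagawaProduct hN hK hH hT Nat.prime_two) ?_ ?_ hM hdiv c hc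
  · -- `hCM`: rationality of `φ(x_m)` over `K[m]` (Gross §3 / Darmon Thm. 3.6) — a THEOREM of the tree
    intro _ hK' _ Dt' β' ι' hβ' M _ m hm _
    exact phi_heegnerPointOfConductor_mem_range_map_ringClassField_of_ne_zero N W K hK' Dt' β' ι' m hβ'
      (Squarefree.ne_zero hm)
  · -- `hAdm`: Gross Lemma 4.3 at `2` on H₂ (`ρ̄₂` onto, odd `d_K`, Heegner for `N_E`)
    subst hN
    intro Dt' β' ι' M n hn _ d
    exact KolyvaginAtTwo.isAdmissible_pointsSubgroup_two_of_heegner d hsurj hK hodd hH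
      (Squarefree.ne_zero hn) M
  · -- `h44`: McCallum 4.4 at the (supersingular) Kolyvagin primes of `2`, from Gross 3.7 (1) (theorem),
    -- Gross 3.7 (2) (named fact) and `a_ℓ = 0` (Deuring on H₂, cmk2-p1 g9)
    subst hN
    intro _ _ hK' ι' P' hHP' M' hM' Dt' β' hND hD n' hn hKol d hcoh hA hPt hI
    exact SylvesterTwoUpper.h44_concrete_of_traceRelation_of_congruence_of_supersingular hK' ι' hHP'
      Nat.prime_two hM'
      (fun ℓ hℓ _ ↦
        CMPointSystemTwo.frobeniusTrace_eq_zero_of_isKolyvaginPrime_two_of_cmInert hCMW hin hsurj hℓ)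
      Dt' hND hD hn hKol d hcoh
      (h372.family_of_grossKolyvaginPrime rfl hK' hD34 hH Dt' β' ι' hn
        (fun q hq ↦ (hKol q hq).1.2.2.2.1) (fun q hq ↦ (hKol q hq).1) d)
      hA hPt hI

/-! ## §2 The refined `(−ε)`-descent on H₂ by name, root hypothesis on the given frame -/

/-- **`2^{M₀−m₁+1}·Sel_{2^M}(E/K)^{ν} = 0` on H₂ when every derived point `P_e(ℓ)` of a datum `e` ON THE GIVEN FRAME
`(Dt, β, ι)` at a deep Kolyvagin prime `ℓ` is `2^{m₁}`-divisible in `E(K[ℓ])`** — hand 7's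
`KolyvaginDescentTwo.two_pow_smul_selmer_minus_eq_zero_of_dvd_derivedPoint_two_pow` with the root hypothesis
restricted to `e : KolyvaginHeegnerData Dt β ι ℓ`: the route's `two_pow_smul_selmer_minus_eq_zero_of_root_two_pow`
(`Δ_E < 0`, `Δ_E ∉ K²`, `c ≠ 1`, Cartan-type `z` with `hzfix`/`hcomm` at level `2^{M+m₁}`, ty2's reciprocity family
`R` at `2`; `2^{M₀} ∥ P` in `E(K)`, `m₁ ≤ M₀`, a sign `ν` with `c P − ν P` non-torsion) fed with the point system of
§1, whose clause (r) lives on the given frame.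
[cite: McCallumLMS1991, §5 Lemma 5.1, Prop. 5.2, Lemma 5.3, Thm. 5.4] [cite: GrossLMS1991, Prop. 2.1 with §10] -/
theorem two_pow_smul_selmer_minus_eq_zero_of_dvd_derivedPoint_onFrame_two_pow [NeZero N] [W.IsGloballyMinimal]
    [W.IsElliptic] (hN : N = W.conductorNorm ℤ) (hCMW : W.HasCM) (hin : CMInert W 2)
    (hsurj : W.HasSurjectiveModNGaloisRep 2) (hT : Odd W.tamagawaProduct)
    (hK : IsImaginaryQuadratic K) (hodd : Odd (NumberField.discr K)) (h3 : NumberField.discr K ≠ -3)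
    (hH : SatisfiesHeegnerHypothesis N K)
    (h372 : GrossLMS1991.prop37_2_reductionCongruence_inert N W K)
    (h53 : ∀ [W.IsElliptic] (_hK : IsImaginaryQuadratic K) (_hH : SatisfiesHeegnerHypothesis N K)
      (Dt : ModularParametrizationData W N) (β : ℤ) (ι : K →+* ℂ) {M : ℕ}
      (_hM : 1 ≤ M) {n : ℕ} (_hn : Squarefree n)
      (_hKol : ∀ q ∈ n.primeFactors, IsKolyvaginPrime N W K 2 q ∧ FrobEqFrobInfty W K (2 ^ M) q)
      (d : (m : ℕ) → m ∣ n → KolyvaginHeegnerData Dt β ι m) (m : ℕ) (hm : m ∣ n)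
      (τm : ringClassField K ι m ≃ₐ[ℚ] ringClassField K ι m),
      (∀ x : ringClassField K ι m, ((τm x : ringClassField K ι m) : ℂ) = starRingEnd ℂ x) →
      ∃ σ' ∈ ringClassGal ι m, IsOfFinAddOrder
        (pointGalHom W (ringClassField K ι m) τm (d m hm).y -
          (-W.rootNumber) • pointGalHom W (ringClassField K ι m) σ' (d m hm).y))
    (hΔ : W.Δ < 0) (hΔK : ¬ IsSquare (W.baseChange K).Δ) {c : K ≃ₐ[ℚ] K} (hc : c ≠ 1)
    (Dt : ModularParametrizationData W N) (β : ℤ) (ι : K →+* ℂ) (d₁ : KolyvaginHeegnerData Dt β ι 1)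
    {P : (W.baseChange K).toAffine.Point} (hHP : IsHeegnerPoint N W K P)
    (hmap : Affine.Point.map (W' := W) (algebraMap K (ringClassField K ι 1)).toRatAlgHom P = d₁.derivedPoint)
    {M : ℕ} (hM : 1 ≤ M) {m₁ : ℕ} {z : absoluteGaloisGroup K}
    (hzfix : ∀ T : geomTorsion (W.baseChange K) ((2 : ℕ) : ℤ), z • T = T → T = 0)
    (hcomm : ∀ π ∈ torsionFixing (W.baseChange K) ((2 : ℕ) : ℤ),
      ∀ T : geomTorsion (W.baseChange K) ((2 ^ (M + m₁) : ℕ) : ℤ), π • z • T = z • π • T)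
    {M₀ : ℕ} (hm₁ : m₁ ≤ M₀)
    (hM₀ : ∃ Q : (W.baseChange K).toAffine.Point, (((2 : ℕ) : ℤ) ^ M₀) • Q = P)
    (hM₀' : ∀ Q : (W.baseChange K).toAffine.Point, (((2 : ℕ) : ℤ) ^ (M₀ + 1)) • Q ≠ P)
    {ν : ℤ} (hν : ν = 1 ∨ ν = -1)
    (hPν : ¬ IsOfFinAddOrder (Affine.Point.map (W' := W) (c : K →ₐ[ℚ] K) P - ν • P))
    (hroots : ∀ ℓ : ℕ, IsKolyvaginPrime N W K 2 ℓ → FrobEqFrobInfty W K (2 ^ (M + m₁)) ℓ →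
      ∀ e : KolyvaginHeegnerData Dt β ι ℓ,
        ∃ Q₀ : (W.baseChange (ringClassField K ι ℓ)).toAffine.Point,
          (((2 : ℕ) : ℤ) ^ m₁) • Q₀ = e.derivedPoint)
    (R : Rank1Residual.P2.KolyvaginMachine.ReciprocityFamily N W K 2 fun _ ↦ True) :
    ∀ s ∈ selmerGroup (W.baseChange K) ((2 ^ M : ℕ) : ℤ), conjAct W c ((2 ^ M : ℕ) : ℤ) s = ν • s →
      (((2 : ℕ) : ℤ) ^ (M₀ - m₁ + 1)) • s = 0 := by
  have hM' : 1 ≤ M + m₁ := hM.trans (Nat.le_add_right M m₁)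
  have hq0' : ((2 ^ (M + m₁) : ℕ) : ℤ) ≠ 0 := by exact_mod_cast pow_ne_zero (M + m₁) two_ne_zero
  have hdiv' : ∀ Q : geomPoints (W.baseChange K), ∃ R, ((2 ^ (M + m₁) : ℕ) : ℤ) • R = Q :=
    (W.baseChange K).zsmul_geomPoints_surjective_holds hq0'
  obtain ⟨ε, τ, hτ, A, hA, Pt, hPt, hε, h1, hAτ, hPt1, hrel⟩ :=
    hpoints_two_with_roots_onFrame_of_cmInert_of_oddTamagawa hN hCMW hin hsurj hT hK hodd h3 hH h372 h53 Dt β ι d₁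
      hHP hmap hM' hdiv' c hc
  let D : Rank1Residual.P2.KolyvaginMachine.PointSystem N W K P 2 (fun _ ↦ True) (M + m₁) hdiv' c :=
    ⟨ε, τ, hτ, A, hA, Pt, hPt, hε, h1, hAτ, hPt1, fun m hm hq ↦
      ⟨(hrel m hm fun q hq' ↦ ⟨(hq q hq').1, (hq q hq').2.1⟩).1,
        (hrel m hm fun q hq' ↦ ⟨(hq q hq').1, (hq q hq').2.1⟩).2.1,
        (hrel m hm fun q hq' ↦ ⟨(hq q hq').1, (hq q hq').2.1⟩).2.2.1⟩⟩
  refine KolyvaginDescentTwo.two_pow_smul_selmer_minus_eq_zero_of_root_two_pow W hK hHP hsurj hΔ hΔK hc hM hzfix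
    hcomm hm₁ hM₀ hM₀' hν hPν D (fun ℓ hℓ hF ↦ ?_) R
  have hℓp : ℓ.Prime := hℓ.prime
  have hkol : ∀ q ∈ ℓ.primeFactors, IsKolyvaginPrime N W K 2 q ∧ FrobEqFrobInfty W K (2 ^ (M + m₁)) q := by
    intro q hq
    rw [hℓp.primeFactors, Finset.mem_singleton] at hq
    subst hq
    exact ⟨hℓ, hF⟩
  exact (hrel ℓ hℓp.squarefree hkol).2.2.2.1 m₁ (hroots ℓ hℓ hF)

/-! ## §3 Kolyvagin's converse at `2` on H₂: the witnessing datum lives on the given frame -/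

/-- **Kolyvagin's converse at `2` on H₂, ON THE GIVEN FRAME (strict descent from the `ν`-Selmer side).**  Under the
hypotheses of `two_pow_smul_selmer_minus_eq_zero_of_dvd_derivedPoint_onFrame_two_pow` (H₂; the route's standing
machine inputs; frame `(Dt, β, ι)` with `d₁` and `P ↦ P(1)`; `2^{M₀} ∥ P`; `m₁ ≤ M₀`), a Selmer class
`s ∈ Sel_{2^M}(E/K)` with `c_* s = ν s` and `2^{M₀−m₁+1}·s ≠ 0` forces a CM-inert Kolyvagin prime `ℓ` at `2` with
`Frob_ℓ = Frob_∞` on `K(E[2^{M+m₁}])` and a Kolyvagin–Heegner datum **`e : KolyvaginHeegnerData Dt β ι ℓ` on the given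
frame** with `2^{m₁} ∤ P_e(ℓ)` in `E(K[ℓ])` (hand 7's `exists_not_dvd_derivedPoint_of_selmer_minus_two_pow`, frame gap
closed; CM-inertness by the route's `cmInert_of_isKolyvaginPrime_two`).
[cite: McCallumLMS1991, §5 Lemma 5.1, Prop. 5.2, Lemma 5.3, Thm. 5.4] [cite: GrossLMS1991, Prop. 2.1 with §10, §3 (3.1)–(3.3)] -/
theorem exists_not_dvd_derivedPoint_onFrame_of_selmer_minus_two_pow [NeZero N] [W.IsGloballyMinimal]
    [W.IsElliptic] (hN : N = W.conductorNorm ℤ) (hCMW : W.HasCM) (hin : CMInert W 2)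
    (hsurj : W.HasSurjectiveModNGaloisRep 2) (hT : Odd W.tamagawaProduct)
    (hK : IsImaginaryQuadratic K) (hodd : Odd (NumberField.discr K)) (h3 : NumberField.discr K ≠ -3)
    (hH : SatisfiesHeegnerHypothesis N K)
    (h372 : GrossLMS1991.prop37_2_reductionCongruence_inert N W K)
    (h53 : ∀ [W.IsElliptic] (_hK : IsImaginaryQuadratic K) (_hH : SatisfiesHeegnerHypothesis N K)
      (Dt : ModularParametrizationData W N) (β : ℤ) (ι : K →+* ℂ) {M : ℕ}
      (_hM : 1 ≤ M) {n : ℕ} (_hn : Squarefree n)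
      (_hKol : ∀ q ∈ n.primeFactors, IsKolyvaginPrime N W K 2 q ∧ FrobEqFrobInfty W K (2 ^ M) q)
      (d : (m : ℕ) → m ∣ n → KolyvaginHeegnerData Dt β ι m) (m : ℕ) (hm : m ∣ n)
      (τm : ringClassField K ι m ≃ₐ[ℚ] ringClassField K ι m),
      (∀ x : ringClassField K ι m, ((τm x : ringClassField K ι m) : ℂ) = starRingEnd ℂ x) →
      ∃ σ' ∈ ringClassGal ι m, IsOfFinAddOrder
        (pointGalHom W (ringClassField K ι m) τm (d m hm).y -
          (-W.rootNumber) • pointGalHom W (ringClassField K ι m) σ' (d m hm).y))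
    (hΔ : W.Δ < 0) (hΔK : ¬ IsSquare (W.baseChange K).Δ) {c : K ≃ₐ[ℚ] K} (hc : c ≠ 1)
    (Dt : ModularParametrizationData W N) (β : ℤ) (ι : K →+* ℂ) (d₁ : KolyvaginHeegnerData Dt β ι 1)
    {P : (W.baseChange K).toAffine.Point} (hHP : IsHeegnerPoint N W K P)
    (hmap : Affine.Point.map (W' := W) (algebraMap K (ringClassField K ι 1)).toRatAlgHom P = d₁.derivedPoint)
    {M : ℕ} (hM : 1 ≤ M) {m₁ : ℕ} {z : absoluteGaloisGroup K}
    (hzfix : ∀ T : geomTorsion (W.baseChange K) ((2 : ℕ) : ℤ), z • T = T → T = 0)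
    (hcomm : ∀ π ∈ torsionFixing (W.baseChange K) ((2 : ℕ) : ℤ),
      ∀ T : geomTorsion (W.baseChange K) ((2 ^ (M + m₁) : ℕ) : ℤ), π • z • T = z • π • T)
    {M₀ : ℕ} (hm₁ : m₁ ≤ M₀)
    (hM₀ : ∃ Q : (W.baseChange K).toAffine.Point, (((2 : ℕ) : ℤ) ^ M₀) • Q = P)
    (hM₀' : ∀ Q : (W.baseChange K).toAffine.Point, (((2 : ℕ) : ℤ) ^ (M₀ + 1)) • Q ≠ P)
    {ν : ℤ} (hν : ν = 1 ∨ ν = -1)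
    (hPν : ¬ IsOfFinAddOrder (Affine.Point.map (W' := W) (c : K →ₐ[ℚ] K) P - ν • P))
    (R : Rank1Residual.P2.KolyvaginMachine.ReciprocityFamily N W K 2 fun _ ↦ True)
    {s : galH1Torsion (W.baseChange K) ((2 ^ M : ℕ) : ℤ)}
    (hs : s ∈ selmerGroup (W.baseChange K) ((2 ^ M : ℕ) : ℤ)) (hsν : conjAct W c ((2 ^ M : ℕ) : ℤ) s = ν • s)
    (hbig : (((2 : ℕ) : ℤ) ^ (M₀ - m₁ + 1)) • s ≠ 0) :
    ∃ ℓ : ℕ, IsKolyvaginPrime N W K 2 ℓ ∧ FrobEqFrobInfty W K (2 ^ (M + m₁)) ℓ ∧ CMInert W ℓ ∧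
      ∃ e : KolyvaginHeegnerData Dt β ι ℓ,
        ∀ Q₀ : (W.baseChange (ringClassField K ι ℓ)).toAffine.Point,
          (((2 : ℕ) : ℤ) ^ m₁) • Q₀ ≠ e.derivedPoint := by
  by_contra hcon
  refine hbig (two_pow_smul_selmer_minus_eq_zero_of_dvd_derivedPoint_onFrame_two_pow hN hCMW hin hsurj hT hK hodd
    h3 hH h372 h53 hΔ hΔK hc Dt β ι d₁ hHP hmap hM hzfix hcomm hm₁ hM₀ hM₀' hν hPν (fun ℓ hℓ hF e ↦ ?_) R s hs hsν)
  have hcm : CMInert W ℓ := by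
    subst hN
    exact KolyvaginDescentTwo.cmInert_of_isKolyvaginPrime_two W hCMW hin hsurj hℓ
  by_contra hroot
  exact hcon ⟨ℓ, hℓ, hF, hcm, e, fun Q₀ hQ₀ ↦ hroot ⟨Q₀, hQ₀⟩⟩

/-- **The strict first step from an element of order `≥ 4`, ON THE GIVEN FRAME** (`m₁ = M₀`): under the same
hypotheses, a class `s ∈ Sel_{2^M}(E/K)` with `c_* s = ν s` and `2·s ≠ 0` forces a CM-inert Kolyvagin prime `ℓ` at
`2` with `Frob_ℓ = Frob_∞` on `K(E[2^{M+M₀}])` and **`e : KolyvaginHeegnerData Dt β ι ℓ`** with `2^{M₀} ∤ P_e(ℓ)` in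
`E(K[ℓ])`, i.e. `m(ℓ) < M₀ = m(1)` — hands 5/6's «one strict step», from the Selmer side, frame gap closed
(hand 7's `exists_strictDescent_of_selmer_minus_two_zsmul_ne_zero`).
[cite: McCallumLMS1991, §5 Lemma 5.1, Prop. 5.2, Thm. 5.4] [cite: GrossLMS1991, Prop. 2.1 with §10] -/
theorem exists_strictDescent_onFrame_of_selmer_minus_two_zsmul_ne_zero [NeZero N] [W.IsGloballyMinimal]
    [W.IsElliptic] (hN : N = W.conductorNorm ℤ) (hCMW : W.HasCM) (hin : CMInert W 2)
    (hsurj : W.HasSurjectiveModNGaloisRep 2) (hT : Odd W.tamagawaProduct)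
    (hK : IsImaginaryQuadratic K) (hodd : Odd (NumberField.discr K)) (h3 : NumberField.discr K ≠ -3)
    (hH : SatisfiesHeegnerHypothesis N K)
    (h372 : GrossLMS1991.prop37_2_reductionCongruence_inert N W K)
    (h53 : ∀ [W.IsElliptic] (_hK : IsImaginaryQuadratic K) (_hH : SatisfiesHeegnerHypothesis N K)
      (Dt : ModularParametrizationData W N) (β : ℤ) (ι : K →+* ℂ) {M : ℕ}
      (_hM : 1 ≤ M) {n : ℕ} (_hn : Squarefree n)
      (_hKol : ∀ q ∈ n.primeFactors, IsKolyvaginPrime N W K 2 q ∧ FrobEqFrobInfty W K (2 ^ M) q)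
      (d : (m : ℕ) → m ∣ n → KolyvaginHeegnerData Dt β ι m) (m : ℕ) (hm : m ∣ n)
      (τm : ringClassField K ι m ≃ₐ[ℚ] ringClassField K ι m),
      (∀ x : ringClassField K ι m, ((τm x : ringClassField K ι m) : ℂ) = starRingEnd ℂ x) →
      ∃ σ' ∈ ringClassGal ι m, IsOfFinAddOrder
        (pointGalHom W (ringClassField K ι m) τm (d m hm).y -
          (-W.rootNumber) • pointGalHom W (ringClassField K ι m) σ' (d m hm).y))
    (hΔ : W.Δ < 0) (hΔK : ¬ IsSquare (W.baseChange K).Δ) {c : K ≃ₐ[ℚ] K} (hc : c ≠ 1)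
    (Dt : ModularParametrizationData W N) (β : ℤ) (ι : K →+* ℂ) (d₁ : KolyvaginHeegnerData Dt β ι 1)
    {P : (W.baseChange K).toAffine.Point} (hHP : IsHeegnerPoint N W K P)
    (hmap : Affine.Point.map (W' := W) (algebraMap K (ringClassField K ι 1)).toRatAlgHom P = d₁.derivedPoint)
    {M : ℕ} (hM : 1 ≤ M) {M₀ : ℕ} {z : absoluteGaloisGroup K}
    (hzfix : ∀ T : geomTorsion (W.baseChange K) ((2 : ℕ) : ℤ), z • T = T → T = 0)
    (hcomm : ∀ π ∈ torsionFixing (W.baseChange K) ((2 : ℕ) : ℤ),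
      ∀ T : geomTorsion (W.baseChange K) ((2 ^ (M + M₀) : ℕ) : ℤ), π • z • T = z • π • T)
    (hM₀ : ∃ Q : (W.baseChange K).toAffine.Point, (((2 : ℕ) : ℤ) ^ M₀) • Q = P)
    (hM₀' : ∀ Q : (W.baseChange K).toAffine.Point, (((2 : ℕ) : ℤ) ^ (M₀ + 1)) • Q ≠ P)
    {ν : ℤ} (hν : ν = 1 ∨ ν = -1)
    (hPν : ¬ IsOfFinAddOrder (Affine.Point.map (W' := W) (c : K →ₐ[ℚ] K) P - ν • P))
    (R : Rank1Residual.P2.KolyvaginMachine.ReciprocityFamily N W K 2 fun _ ↦ True)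
    {s : galH1Torsion (W.baseChange K) ((2 ^ M : ℕ) : ℤ)}
    (hs : s ∈ selmerGroup (W.baseChange K) ((2 ^ M : ℕ) : ℤ)) (hsν : conjAct W c ((2 ^ M : ℕ) : ℤ) s = ν • s)
    (h2 : ((2 : ℕ) : ℤ) • s ≠ 0) :
    ∃ ℓ : ℕ, IsKolyvaginPrime N W K 2 ℓ ∧ FrobEqFrobInfty W K (2 ^ (M + M₀)) ℓ ∧ CMInert W ℓ ∧
      ∃ e : KolyvaginHeegnerData Dt β ι ℓ,
        ∀ Q₀ : (W.baseChange (ringClassField K ι ℓ)).toAffine.Point,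
          (((2 : ℕ) : ℤ) ^ M₀) • Q₀ ≠ e.derivedPoint :=
  exists_not_dvd_derivedPoint_onFrame_of_selmer_minus_two_pow hN hCMW hin hsurj hT hK hodd h3 hH h372 h53 hΔ hΔK hc
    Dt β ι d₁ hHP hmap hM hzfix hcomm le_rfl hM₀ hM₀' hν hPν R hs hsν (by rwa [Nat.sub_self, zero_add, pow_one])

end Summit.BirchSwinnertonDyer.BirchSwinnertonDyer.Theorems.KolyvaginDescentTwoOnGivenFrame

end

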